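import Summits.BirchSwinnertonDyer.BirchSwinnertonDyer.Theorems.AlignedTransportAtTwoMainConjectureOfRankZeroBSDAtTwoCubicPrimesOfEmbeddings
import Summits.BirchSwinnertonDyer.BirchSwinnertonDyer.Theorems.ByReductionTypeAtTwoFineSelmerConjAAtTwoAdditivePotGoodChevalleyPadicCertificate
import HarnessLib

/-!
# Route `AlignedTransportAtTwo`, crux C2 `MainConjectureOfRankZeroBSDAtTwo` (stmt-BirchSwinnertonDyer-22298):
# THE CHEVALLEY UNIT BIT IS ONE `2`-ADIC SIGN — the canonical odd root of `c_V` in `ℤ₂` is isolated and congruence-pinned, and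
# «`ε` is not a norm from `F(√2)`» follows from a FINITE certificate (generic cubic `2`-torsion field `F`)

HONEST FRAMING (cell `bsd-f1-sign2`, WIDTH-5 attached prover seat `bsd-line-att-p5` gen 29 on line `birth` of the lead `bsd-line-att-p2`;
`--supports` stmt-BirchSwinnertonDyer-22298, closes nothing; BSD is NOT proved by any of this; the crux C2, its verdict «blocked-on
`Rank1Residual.GreenbergMuConjectureIrreducible`» and every registered stub are untouched). THEOREMS ONLY — no definition, no named fact,
no `sorry`. After att-p5 g28 the cubic class-group road OFF the Kilford stratum displays, besides PRINT⁵ + MuIneqʳ, exactly the two bits of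
Chevalley's `(0,1)` door: `h(ℚ(β))` odd and a unit `ε` of `𝓞 ℚ(β)` with the INFINITE hypothesis `∀ a b : ℚ(β), ε ≠ a² − 2b²`. This file makes
the second bit KERNEL-DECIDABLE on the cubic road. The sibling cell bsd-wall has the certificate for `ℚ(θ)`, `θ` a root of a monic integer cubic,
with ODD denominators only (`AddKatoTwo.not_sqSubTwoSq_of_padicCert`); units of `𝓞 ℚ(β)` written on `1, u, u²` (`u = 4x(T)`, the tree's
`twoDivisionUCubic`) carry `2`-power denominators, so the cubic road needs the version below, stated for ANY cubic field `F ∋ e₁` with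
`c_V(e₁) = 0` (the carrier of att-p4's rank ledgers and of att-p5's `ℚ(β)`).

WHAT.
* §1 (pure `ℤ₂`) **`toZModPow_eq_intCast_of_odd_root`**: an odd root `e` of `X³ + b₂X² + 8b₄X + 16b₆` (`bᵢ ∈ ℤ` arbitrary) satisfies
  `c(a) = (a − e)·unit` for every odd integer `a`, so `2^N ∣ c(a)` gives `e ≡ a (mod 2^N)`; **`eq_of_odd_roots`** (the odd root is unique).
* §2 (`V/ℚ` globally minimal, good ORDINARY at `2`) **`exists_odd_root`** (the tree's canonical odd-unit root, integer form),
  **`toZModPow_oddRoot_eq`** (pinned by any odd approximate root), **`toZModPow_three_oddRoot_eq_neg_b₂`** (`e ≡ −b₂ (mod 8)`, no Hensel search: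
  `c_V(−b₂) = 8(2b₆ − b₂b₄)` identically), **`exists_algHom_padic_map_eq`** (`E_V(ℚ)[2] = 0`, `F` cubic ∋ `e₁`: `σ : F →ₐ ℚ₂`, `e₁ ↦ e`).
* §3 **`forall_ne_sq_sub_two_mul_sq_of_signCert`** — THE SIGN CERTIFICATE: `ε = P(e₁)/(2^k m)`, `P ∈ ℤ[X]`, `m m' ≡ 1 (mod 8)`, an odd `a` with
  `2^(k+3) ∣ c_V(a)` and `P(a)·m' ≡ 2^k·c (mod 2^(k+3))`, `c ∈ {3, 5}` ⟹ `∀ α β : F, ε ≠ α² − 2β²` (`σ(ε) ≡ ±3 (mod 8)` in `ℤ₂`: Hilbert symbol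
  `(σ(ε), 2)₂ = −1`, bsd-wall's `AddKatoTwo.padicInt_two_not_norm`).
* §4 **`exists_isUnit_ringOfIntegers_of_cubicUnitEq`** (`ε³ − Tε² + Sε ∓ 1 = 0` ⟹ `ε` is a unit of `𝓞 F`) and
  **`exists_isUnit_forall_ne_sq_sub_two_mul_sq_of_certs`**: BOTH displayed inputs (`hεu`, `hnn`) of bsd-2adic's Chevalley door
  `AddKatoTwo.classNumberPExp_one_eq_zero_of_nonNorm_unit_two` from finitely many integers and one field identity.

NOT here: the `ℚ(β)` doors (sequel `…CubicChevalleyUnitSignDoors`); the converse «some non-norm unit is NECESSARY off the stratum» (sequel);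
that a non-norm unit is always detected by THIS sign is Hasse's norm theorem + the product formula, not kernel. Nothing is asserted about any
curve's units or class groups; nothing is closed; BSD is not proved.

References: [Serre1973] Ch. II §2.2 (Hensel/Newton), Ch. III §1.2 Thm. 1 (`(u,2)₂`); [NeukirchANT1999] Ch. II §8 (embeddings and primes);
[Lang1990] Ch. 13 §4 Lemma 4.1; [SilvermanAEC2009] VII.2, V.4; tree: att-p5 g26 `…CubicPrimesOfEmbeddings` / `…KilfordStratum`
(`exists_padicInt_root_of_isOrdinaryAt_two`), bsd-wall `…AdditivePotGoodChevalleyPadicCertificate`, `…AlignedTransportAtTwoBridge`.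
-/

set_option linter.dupNamespace false
set_option autoImplicit false

noncomputable section

open scoped Classical NumberField nonZeroDivisors

namespace Summit.BirchSwinnertonDyer.BirchSwinnertonDyer.Theorems.AlignedTransportAtTwoCubicChevalleyUnitSign

open NumberField IsDedekindDomain Polynomial WeierstrassCurve IntermediateField
  Literature.NumberTheory.EllipticCurves Literature.NumberTheory.EllipticCurves.Greenberg1999
  Summit.BirchSwinnertonDyer.Rank1Residual.F1Sign2
  Summit.BirchSwinnertonDyer.BirchSwinnertonDyer.Theorems.AlignedTransportAtTwoBridge
  Summit.BirchSwinnertonDyer.BirchSwinnertonDyer.Theorems.AlignedTransportAtTwoKilfordStratumShared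
  Summit.BirchSwinnertonDyer.BirchSwinnertonDyer.Theorems.AlignedTransportAtTwoKilfordStratum

/-! ## §1 Odd `2`-adic integers and the cofactor of the `u`-cubic -/

/-- A `2`-adic integer not divisible by `2` is `1 + 2t`. [folklore] -/
theorem exists_eq_one_add_two_mul_of_not_two_dvd {e : ℤ_[2]} (he : ¬ (2 : ℤ_[2]) ∣ e) :
    ∃ t : ℤ_[2], e = 1 + 2 * t := by
  have h1 : PadicInt.toZMod (p := 2) e ≠ 0 := by
    intro h0
    apply he
    have : e ∈ RingHom.ker (PadicInt.toZMod (p := 2)) := by rwa [RingHom.mem_ker]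
    rw [PadicInt.ker_toZMod, PadicInt.maximalIdeal_eq_span_p, Ideal.mem_span_singleton] at this
    exact_mod_cast this
  have key : ∀ x : ZMod 2, x ≠ 0 → x = 1 := by decide
  have h2 : PadicInt.toZMod (p := 2) e = 1 := key _ h1
  have h3 : e - 1 ∈ RingHom.ker (PadicInt.toZMod (p := 2)) := by
    rw [RingHom.mem_ker, map_sub, h2, map_one, sub_self]
  rw [PadicInt.ker_toZMod, PadicInt.maximalIdeal_eq_span_p, Ideal.mem_span_singleton] at h3
  obtain ⟨t, ht⟩ := h3
  exact ⟨t, by linear_combination ht⟩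

/-- `‖e‖ = 1` ⟹ `2 ∤ e` in `ℤ₂`. [folklore] -/
theorem not_two_dvd_of_norm_eq_one {e : ℤ_[2]} (he : ‖e‖ = 1) : ¬ (2 : ℤ_[2]) ∣ e := by
  intro hd
  have := (PadicInt.norm_lt_one_iff_dvd e).mpr (by exact_mod_cast hd)
  rw [he] at this
  exact lt_irrefl _ this

/-- An element of `ℤ₂` of the form `1 + 2t` is a unit. [folklore] -/
theorem isUnit_of_eq_one_add_two_mul {y : ℤ_[2]} (t : ℤ_[2]) (h : y = 1 + 2 * t) : IsUnit y := by
  rw [h, PadicInt.isUnit_iff]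
  by_contra hne
  obtain ⟨c, hc⟩ := (PadicInt.norm_lt_one_iff_dvd _).mp (lt_of_le_of_ne (PadicInt.norm_le_one _) hne)
  have h1 : (2 : ℤ_[2]) ∣ 1 := ⟨c - t, by linear_combination hc⟩
  have := (PadicInt.norm_lt_one_iff_dvd (1 : ℤ_[2])).mpr (by exact_mod_cast h1)
  rw [norm_one] at this
  exact lt_irrefl _ this

/-- **THE ODD ROOT IS `2`-ADICALLY ISOLATED.** For ANY integers `b₂, b₄, b₆`, an odd root `e ∈ ℤ₂` of
`c = X³ + b₂X² + 8b₄X + 16b₆` and ANY odd integer `a`: `c(a) = (a − e)·S` with `S = a² + ae + e² + b₂(a + e) + 8b₄` a `2`-adic UNIT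
(three odd squares/products, `a + e` even). Hence `2^N ∣ c(a)` forces `e ≡ a (mod 2^N)`: the odd root is unique and every odd
approximate root pins it to the precision of its residual — no Hensel search. [folklore; cite: Serre1973, Ch. II §2.2] -/
theorem toZModPow_eq_intCast_of_odd_root (b₂ b₄ b₆ : ℤ) {e : ℤ_[2]} (he2 : ¬ (2 : ℤ_[2]) ∣ e)
    (he : e ^ 3 + (b₂ : ℤ_[2]) * e ^ 2 + 8 * (b₄ : ℤ_[2]) * e + 16 * (b₆ : ℤ_[2]) = 0) {a : ℤ} (ha : Odd a) (N : ℕ)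
    (hN : (2 : ℤ) ^ N ∣ a ^ 3 + b₂ * a ^ 2 + 8 * b₄ * a + 16 * b₆) :
    PadicInt.toZModPow N e = ((a : ℤ) : ZMod (2 ^ N)) := by
  obtain ⟨t, ht⟩ := exists_eq_one_add_two_mul_of_not_two_dvd he2
  obtain ⟨s, hs⟩ := ha
  -- the cofactor `S` and the factorisation `c(a) = (a - e) S`
  set S : ℤ_[2] := (a : ℤ_[2]) ^ 2 + (a : ℤ_[2]) * e + e ^ 2 + (b₂ : ℤ_[2]) * ((a : ℤ_[2]) + e) + 8 * (b₄ : ℤ_[2])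
    with hSdef
  have hfac : ((a : ℤ_[2]) - e) * S = ((a ^ 3 + b₂ * a ^ 2 + 8 * b₄ * a + 16 * b₆ : ℤ) : ℤ_[2]) := by
    rw [hSdef]; push_cast; linear_combination (-1 : ℤ_[2]) * he
  -- `S = 1 + 2·(…)` is a unit
  have hS1 : S = 1 + 2 * (2 * (s : ℤ_[2]) ^ 2 + 2 * s + 2 * s * t + s + t + 2 * t ^ 2 + 2 * t + 1 +
      (b₂ : ℤ_[2]) * (s + t + 1) + 4 * b₄) := by
    rw [hSdef, ht, hs]; push_cast; ring
  obtain ⟨u, hu⟩ := isUnit_of_eq_one_add_two_mul _ hS1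
  obtain ⟨k, hk⟩ := hN
  have hae : (a : ℤ_[2]) - e = 2 ^ N * ((k : ℤ_[2]) * ↑u⁻¹) := by
    have h1 : ((a : ℤ_[2]) - e) * ↑u = ((2 : ℤ) ^ N * k : ℤ) := by rw [hu, hfac, hk]
    have h2 : (a : ℤ_[2]) - e = (((2 : ℤ) ^ N * k : ℤ) : ℤ_[2]) * ↑u⁻¹ := by
      rw [← h1, mul_assoc, Units.mul_inv, mul_one]
    rw [h2]; push_cast; ring
  have hker : (a : ℤ_[2]) - e ∈ RingHom.ker (PadicInt.toZModPow (p := 2) N) := by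
    rw [PadicInt.ker_toZModPow, Ideal.mem_span_singleton]
    exact ⟨(k : ℤ_[2]) * ↑u⁻¹, hae⟩
  rw [RingHom.mem_ker, map_sub, sub_eq_zero, map_intCast] at hker
  exact hker.symm

/-- **UNIQUENESS OF THE ODD ROOT**: two odd roots of `X³ + b₂X² + 8b₄X + 16b₆` in `ℤ₂` coincide. [folklore] -/
theorem eq_of_odd_roots (b₂ b₄ b₆ : ℤ) {e e' : ℤ_[2]} (he2 : ¬ (2 : ℤ_[2]) ∣ e) (he'2 : ¬ (2 : ℤ_[2]) ∣ e')
    (he : e ^ 3 + (b₂ : ℤ_[2]) * e ^ 2 + 8 * (b₄ : ℤ_[2]) * e + 16 * (b₆ : ℤ_[2]) = 0)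
    (he' : e' ^ 3 + (b₂ : ℤ_[2]) * e' ^ 2 + 8 * (b₄ : ℤ_[2]) * e' + 16 * (b₆ : ℤ_[2]) = 0) :
    e = e' := by
  obtain ⟨t, ht⟩ := exists_eq_one_add_two_mul_of_not_two_dvd he2
  obtain ⟨t', ht'⟩ := exists_eq_one_add_two_mul_of_not_two_dvd he'2
  set S : ℤ_[2] := e' ^ 2 + e' * e + e ^ 2 + (b₂ : ℤ_[2]) * (e' + e) + 8 * (b₄ : ℤ_[2]) with hSdef
  have hfac : (e' - e) * S = 0 := by rw [hSdef]; linear_combination he' - he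
  have hS1 : S = 1 + 2 * (2 * t' ^ 2 + 2 * t' + 2 * t' * t + t' + t + 2 * t ^ 2 + 2 * t + 1 +
      (b₂ : ℤ_[2]) * (t' + t + 1) + 4 * b₄) := by
    rw [hSdef, ht, ht']; ring
  obtain ⟨u, hu⟩ := isUnit_of_eq_one_add_two_mul _ hS1
  rw [← hu] at hfac
  have := Units.mul_left_eq_zero u |>.mp hfac
  linear_combination (-1 : ℤ_[2]) * this

/-! ## §2 The canonical odd root of `c_V` (good ordinary at `2`) and the `2`-adic embedding of a cubic `2`-torsion field -/

section Cubic

variable (V : WeierstrassCurve ℚ) [V.IsElliptic] [V.IsGloballyMinimal]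

omit [V.IsElliptic] in
/-- A `2`-adic-integer root of `twoDivisionUCubic V` (in `ℚ₂`) is a root of the INTEGER cubic `u³ + b₂u² + 8b₄u + 16b₆` of the
minimal model, in `ℤ₂`. [folklore] -/
theorem cubicInt_eq_zero_of_aeval_eq_zero {e : ℤ_[2]} (he : aeval (e : ℚ_[2]) (twoDivisionUCubic V) = 0) :
    e ^ 3 + ((integralModelInt V).b₂ : ℤ_[2]) * e ^ 2 + 8 * ((integralModelInt V).b₄ : ℤ_[2]) * e +
      16 * ((integralModelInt V).b₆ : ℤ_[2]) = 0 := by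
  have h := he
  simp only [twoDivisionUCubic, map_add, map_mul, map_pow, aeval_X, aeval_C, eq_ratCast] at h
  rw [← ratCast_b₂_integralModelInt, ← ratCast_b₄_integralModelInt, ← ratCast_b₆_integralModelInt] at h
  push_cast at h
  have h8 : ((8 : ℤ_[2]) : ℚ_[2]) = 8 := rfl
  have h16 : ((16 : ℤ_[2]) : ℚ_[2]) = 16 := rfl
  have h' : ((e ^ 3 + ((integralModelInt V).b₂ : ℤ_[2]) * e ^ 2 + 8 * ((integralModelInt V).b₄ : ℤ_[2]) * e +
      16 * ((integralModelInt V).b₆ : ℤ_[2]) : ℤ_[2]) : ℚ_[2]) = ((0 : ℤ_[2]) : ℚ_[2]) := by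
    push_cast [h8, h16]; linear_combination h
  exact Subtype.ext h'

/-- **The canonical odd root, integer form.** For `V/ℚ` globally minimal with good ORDINARY reduction at `2` the `u`-cubic
`c_V = u³ + b₂u² + 8b₄u + 16b₆ ∈ ℤ[u]` (`b₂` odd) has a root `e ∈ ℤ₂` with `2 ∤ e` (tree `exists_padicInt_root_of_isOrdinaryAt_two`,
restated with the integer coefficients of the minimal model and as a root of `twoDivisionUCubic V` in `ℚ₂`).
[cite: SilvermanAEC2009, VII.2 and V.4] -/
theorem exists_odd_root (hord : IsOrdinaryAt V 2) :
    ∃ e : ℤ_[2], ¬ (2 : ℤ_[2]) ∣ e ∧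
      e ^ 3 + ((integralModelInt V).b₂ : ℤ_[2]) * e ^ 2 + 8 * ((integralModelInt V).b₄ : ℤ_[2]) * e +
          16 * ((integralModelInt V).b₆ : ℤ_[2]) = 0 ∧
      aeval (e : ℚ_[2]) (twoDivisionUCubic V) = 0 := by
  obtain ⟨e, he1, he⟩ := exists_padicInt_root_of_isOrdinaryAt_two V hord
  exact ⟨e, not_two_dvd_of_norm_eq_one he1, cubicInt_eq_zero_of_aeval_eq_zero V he, he⟩

omit [V.IsElliptic] in
/-- **The canonical odd root is pinned by any odd approximate root**: with `e` as above and `a` an odd integer with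
`2^N ∣ c_V(a)`, `e ≡ a (mod 2^N)`. Taking `a = −b₂`, `N = 3`: `e ≡ −b₂ (mod 8)` always (`c_V(a) ≡ a²(a + b₂) (mod 8)`).
[folklore; cite: Serre1973, Ch. II §2.2] -/
theorem toZModPow_oddRoot_eq {e : ℤ_[2]} (he2 : ¬ (2 : ℤ_[2]) ∣ e)
    (he : aeval (e : ℚ_[2]) (twoDivisionUCubic V) = 0) {a : ℤ} (ha : Odd a) (N : ℕ)
    (hN : (2 : ℤ) ^ N ∣ a ^ 3 + (integralModelInt V).b₂ * a ^ 2 + 8 * (integralModelInt V).b₄ * a + 16 * (integralModelInt V).b₆) :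
    PadicInt.toZModPow N e = ((a : ℤ) : ZMod (2 ^ N)) :=
  toZModPow_eq_intCast_of_odd_root _ _ _ he2 (cubicInt_eq_zero_of_aeval_eq_zero V he) ha N hN

omit [V.IsElliptic] in
/-- **`c_V(−b₂) ≡ 0 (mod 8)`**, identically (`(−b₂)³ + b₂·b₂² = 0`): `a = −b₂` is an admissible approximate root at precision `8`
whenever it is odd (good ordinary at `2`), so the canonical odd root is `≡ −b₂ (mod 8)`. [folklore] -/
theorem eight_dvd_cubic_neg_b₂ :
    (2 : ℤ) ^ 3 ∣ (-(integralModelInt V).b₂) ^ 3 + (integralModelInt V).b₂ * (-(integralModelInt V).b₂) ^ 2 +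
      8 * (integralModelInt V).b₄ * (-(integralModelInt V).b₂) + 16 * (integralModelInt V).b₆ :=
  ⟨-(integralModelInt V).b₄ * (integralModelInt V).b₂ + 2 * (integralModelInt V).b₆, by ring⟩

/-- **The canonical odd root is `≡ −b₂ (mod 8)`.** [folklore] -/
theorem toZModPow_three_oddRoot_eq_neg_b₂ (hord : IsOrdinaryAt V 2) {e : ℤ_[2]} (he2 : ¬ (2 : ℤ_[2]) ∣ e)
    (he : aeval (e : ℚ_[2]) (twoDivisionUCubic V) = 0) :
    PadicInt.toZModPow 3 e = ((-(integralModelInt V).b₂ : ℤ) : ZMod (2 ^ 3)) :=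
  toZModPow_oddRoot_eq V he2 he (odd_b₂_of_isOrdinaryAt_two V hord).neg 3 (eight_dvd_cubic_neg_b₂ V)

omit [V.IsElliptic] [V.IsGloballyMinimal] in
/-- **The `2`-adic embedding of a cubic `2`-torsion field along a `2`-adic root.** `E_V(ℚ)[2] = 0`, `F` a cubic number field with a
root `e₁` of `c_V`, `y ∈ ℚ₂` a root of `c_V` ⟹ a `ℚ`-algebra map `σ : F → ℚ₂` with `σ(e₁) = y` (`F = ℚ(e₁)`, power basis).
[cite: NeukirchANT1999, Ch. II §8 (8.1)–(8.3)] -/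
theorem exists_algHom_padic_map_eq (ht : ∀ x : ℚ, ¬ HasRationalTwoTorsionX V x) {F : Type} [Field F] [NumberField F]
    (hF : Module.finrank ℚ F = 3) {e₁ : F} (he₁ : aeval e₁ (twoDivisionUCubic V) = 0) {y : ℚ_[2]}
    (hy : aeval y (twoDivisionUCubic V) = 0) : ∃ σ : F →ₐ[ℚ] ℚ_[2], σ e₁ = y := by
  have hmin : minpoly ℚ e₁ = twoDivisionUCubic V := minpoly_eq_twoDivisionUCubic V ht he₁
  obtain ⟨pb, hgen, -⟩ := exists_powerBasis_gen_eq (natDegree_twoDivisionUCubic V) hF hmin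
  have hroot : aeval y (minpoly ℚ pb.gen) = 0 := by rw [hgen, hmin]; exact hy
  exact ⟨pb.lift y hroot, by rw [← hgen]; exact pb.lift_gen y hroot⟩

end Cubic

/-! ## §3 THE SIGN CERTIFICATE: `ε = P(e₁)/(2^k m)` is not a norm from `F(√2)` -/

section Sign

variable (V : WeierstrassCurve ℚ) [V.IsElliptic] [V.IsGloballyMinimal]

/-- `m·m' ≡ 1 (mod 8)` makes `m` a `2`-adic unit with `m·m' = 1 + 8s` in `ℤ₂`. [folklore] -/
theorem exists_mul_eq_one_add_eight_mul {m m' : ℤ} (hmm : ((m * m' : ℤ) : ZMod (2 ^ 3)) = 1) :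
    ∃ s : ℤ_[2], (m : ℤ_[2]) * m' = 1 + 8 * s := by
  have hker : (m : ℤ_[2]) * m' - 1 ∈ RingHom.ker (PadicInt.toZModPow (p := 2) 3) := by
    rw [RingHom.mem_ker, map_sub, map_one, ← Int.cast_mul, map_intCast, hmm, sub_self]
  rw [PadicInt.ker_toZModPow, Ideal.mem_span_singleton] at hker
  obtain ⟨s, hs⟩ := hker
  exact ⟨s, by linear_combination hs⟩

/-- Evaluating an integer polynomial commutes with `toZModPow`: `P(e) mod 2^N = P(e mod 2^N)`. [folklore] -/
theorem toZModPow_aeval (N : ℕ) (e : ℤ_[2]) (P : ℤ[X]) :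
    PadicInt.toZModPow N (aeval e P) = aeval (PadicInt.toZModPow N e) P :=
  (aeval_algHom_apply ((PadicInt.toZModPow (p := 2) N).toIntAlgHom) e P).symm

/-- `P(a)` in `ZMod n` is the cast of the integer `P.eval a`. [folklore] -/
theorem aeval_intCast_zmod (n : ℕ) (a : ℤ) (P : ℤ[X]) : aeval ((a : ℤ) : ZMod n) P = ((P.eval a : ℤ) : ZMod n) := by
  rw [aeval_def, ← eval_map, algebraMap_int_eq, eval_intCast_map, Int.cast_id, eq_intCast]

/-- **THE `2`-ADIC SIGN CERTIFICATE (generic cubic `2`-torsion field).** `V/ℚ` globally minimal, good ORDINARY at `2`, no rational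
`2`-torsion abscissa; `F` a cubic number field with a root `e₁` of `c_V = u³ + b₂u² + 8b₄u + 16b₆`; `ε = P(e₁)/(2^k·m) ∈ F` with
`P ∈ ℤ[X]`, `m·m' ≡ 1 (mod 8)`.  CERTIFICATE: an odd integer `a` with `2^(k+3) ∣ c_V(a)` (so the canonical odd root is `≡ a`) and
`P(a)·m' ≡ 2^k·c (mod 2^(k+3))` with `c ∈ {3, 5}`.  THEN `ε ≠ α² − 2β²` for all `α, β ∈ F`: along the embedding `σ : F → ℚ₂`,
`e₁ ↦ e` (the odd root), `σ(ε) = (c + 8t)(1 + 8s)⁻¹ ≡ ±3 (mod 8)` is a `2`-adic unit with Hilbert symbol `(σ(ε), 2)₂ = −1`, i.e. not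
a norm from `ℚ₂(√2)` (bsd-wall `AddKatoTwo.padicInt_two_not_norm`).  Two-power denominators are allowed (`k ≥ 0`), which the
coordinates of units on `1, u, u²` (`u = 4x(T)`) require. [cite: Serre1973, Ch. III §1.2 Thm. 1] [cite: NeukirchANT1999, Ch. II §8] -/
theorem forall_ne_sq_sub_two_mul_sq_of_signCert (hord : IsOrdinaryAt V 2) (ht : ∀ x : ℚ, ¬ HasRationalTwoTorsionX V x)
    {F : Type} [Field F] [NumberField F] (hF : Module.finrank ℚ F = 3) {e₁ : F} (he₁ : aeval e₁ (twoDivisionUCubic V) = 0)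
    (P : ℤ[X]) (k : ℕ) (m m' a c : ℤ) (hc : c = 3 ∨ c = 5) (ha : Odd a)
    (hroot : (2 : ℤ) ^ (k + 3) ∣
      a ^ 3 + (integralModelInt V).b₂ * a ^ 2 + 8 * (integralModelInt V).b₄ * a + 16 * (integralModelInt V).b₆)
    (hmm : ((m * m' : ℤ) : ZMod (2 ^ 3)) = 1)
    (hcert : ((P.eval a * m' : ℤ) : ZMod (2 ^ (k + 3))) = ((2 ^ k * c : ℤ) : ZMod (2 ^ (k + 3)))) :
    ∀ α β : F, aeval e₁ (P.map (Int.castRingHom ℚ)) / (2 ^ k * (m : F)) ≠ α ^ 2 - 2 * β ^ 2 := by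
  intro α β hEq
  -- the canonical odd root and the embedding along it
  obtain ⟨e, he2, -, heQ⟩ := exists_odd_root V hord
  obtain ⟨σ, hσ⟩ := exists_algHom_padic_map_eq V ht hF he₁ heQ
  have hea : PadicInt.toZModPow (k + 3) e = ((a : ℤ) : ZMod (2 ^ (k + 3))) := toZModPow_oddRoot_eq V he2 heQ ha (k + 3) hroot
  -- `P(e)·m' = 2^k (c + 8 t)` in `ℤ₂`
  have hPe : PadicInt.toZModPow (k + 3) (aeval e P * (m' : ℤ_[2])) = ((2 ^ k * c : ℤ) : ZMod (2 ^ (k + 3))) := by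
    rw [map_mul, toZModPow_aeval, hea, aeval_intCast_zmod, map_intCast, ← Int.cast_mul, hcert]
  have hker : aeval e P * (m' : ℤ_[2]) - ((2 ^ k * c : ℤ) : ℤ_[2]) ∈ RingHom.ker (PadicInt.toZModPow (p := 2) (k + 3)) := by
    rw [RingHom.mem_ker, map_sub, hPe, map_intCast, sub_self]
  rw [PadicInt.ker_toZModPow, Ideal.mem_span_singleton] at hker
  obtain ⟨t, ht'⟩ := hker
  have hPe' : aeval e P * (m' : ℤ_[2]) = 2 ^ k * ((c : ℤ_[2]) + 8 * t) := by
    have := ht'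
    push_cast at this
    linear_combination this
  -- `m m' = 1 + 8 s`, a unit
  obtain ⟨s, hs⟩ := exists_mul_eq_one_add_eight_mul hmm
  obtain ⟨U, hU'⟩ := isUnit_of_eq_one_add_two_mul (4 * s) (show (m : ℤ_[2]) * m' = 1 + 2 * (4 * s) by rw [hs]; ring)
  -- the `2`-adic image `u₀ = (c + 8t)·(m m')⁻¹`, `≡ c (mod 8)`
  set u₀ : ℤ_[2] := ((c : ℤ_[2]) + 8 * t) * ↑U⁻¹ with hu₀
  have hUres : PadicInt.toZModPow 3 (↑U⁻¹ : ℤ_[2]) = 1 := by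
    have h1 : PadicInt.toZModPow 3 (↑U⁻¹ : ℤ_[2]) * PadicInt.toZModPow 3 (U : ℤ_[2]) = 1 := by
      rw [← map_mul, Units.inv_mul, map_one]
    have h2 : PadicInt.toZModPow 3 (U : ℤ_[2]) = 1 := by
      rw [hU', ← Int.cast_mul, map_intCast]; exact hmm
    rwa [h2, mul_one] at h1
  have hu35 : PadicInt.toZModPow 3 u₀ = 3 ∨ PadicInt.toZModPow 3 u₀ = 5 := by
    have h8 : PadicInt.toZModPow 3 (8 : ℤ_[2]) = 0 := by
      have : (8 : ℤ_[2]) ∈ RingHom.ker (PadicInt.toZModPow (p := 2) 3) := by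
        rw [PadicInt.ker_toZModPow, Ideal.mem_span_singleton]; exact ⟨1, by norm_num⟩
      exact (RingHom.mem_ker).mp this
    have : PadicInt.toZModPow 3 u₀ = ((c : ℤ) : ZMod (2 ^ 3)) := by
      rw [hu₀, map_mul, hUres, mul_one, map_add, map_mul, h8, zero_mul, add_zero, map_intCast]
    rw [this]
    rcases hc with rfl | rfl
    · left; rfl
    · right; rfl
  -- the image of `ε` under `σ` is `u₀`
  have hm0 : (m : ℚ_[2]) ≠ 0 := by
    intro h0
    have hU0 : ((U : ℤ_[2]) : ℚ_[2]) = 0 := by rw [hU']; push_cast; rw [h0, zero_mul]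
    exact U.ne_zero (Subtype.ext hU0)
  have h2k : (2 : ℚ_[2]) ^ k ≠ 0 := pow_ne_zero _ two_ne_zero
  have hσP : σ (aeval e₁ (P.map (Int.castRingHom ℚ))) = ((aeval e P : ℤ_[2]) : ℚ_[2]) := by
    rw [← algebraMap_int_eq, aeval_map_algebraMap]
    have h1 : σ (aeval e₁ P) = aeval (σ e₁) P := (aeval_algHom_apply ((σ : F →+* ℚ_[2]).toIntAlgHom) e₁ P).symm
    have h2 : ((aeval e P : ℤ_[2]) : ℚ_[2]) = aeval (e : ℚ_[2]) P :=
      (aeval_algHom_apply ((PadicInt.Coe.ringHom (p := 2)).toIntAlgHom) e P).symm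
    rw [h1, hσ, h2]
  have hUQ : ((U : ℤ_[2]) : ℚ_[2]) ≠ 0 := fun h => U.ne_zero (Subtype.ext h)
  have hUinv : ((↑U⁻¹ : ℤ_[2]) : ℚ_[2]) = (((U : ℤ_[2]) : ℚ_[2]))⁻¹ := by
    have : ((↑U⁻¹ : ℤ_[2]) : ℚ_[2]) * ((U : ℤ_[2]) : ℚ_[2]) = 1 := by
      rw [← PadicInt.coe_mul, Units.inv_mul]; rfl
    exact eq_inv_of_mul_eq_one_left this
  have h8Q : ((8 : ℤ_[2]) : ℚ_[2]) = 8 := rfl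
  have h2Q : ((2 : ℤ_[2]) : ℚ_[2]) = 2 := rfl
  have hσε : σ (aeval e₁ (P.map (Int.castRingHom ℚ)) / (2 ^ k * (m : F))) = (u₀ : ℚ_[2]) := by
    rw [map_div₀, hσP, map_mul, map_pow, map_ofNat, map_intCast]
    have hPeQ : ((aeval e P : ℤ_[2]) : ℚ_[2]) * (m' : ℚ_[2]) = 2 ^ k * ((c : ℚ_[2]) + 8 * (t : ℚ_[2])) := by
      have := congrArg ((↑) : ℤ_[2] → ℚ_[2]) hPe'
      push_cast [h8Q, h2Q] at this
      exact this
    have hUQ' : ((U : ℤ_[2]) : ℚ_[2]) = (m : ℚ_[2]) * m' := by rw [hU']; push_cast; ring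
    rw [hu₀]; push_cast [h8Q]; rw [hUinv, hUQ']
    have hm'0 : (m' : ℚ_[2]) ≠ 0 := by
      intro h0; apply hUQ; rw [hUQ', h0, mul_zero]
    field_simp
    linear_combination hPeQ
  -- conclude with the local non-norm criterion
  have himg := congrArg σ hEq
  rw [hσε, map_sub, map_mul, map_pow, map_pow, map_ofNat] at himg
  exact AddKatoTwo.padicInt_two_not_norm u₀ hu35 (σ α) (σ β) himg

end Sign

/-! ## §4 THE UNIT CERTIFICATE: `ε³ − Tε² + Sε ∓ 1 = 0` makes `ε` a unit of `𝓞 F` -/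

section UnitCert

/-- **A root of `X³ − TX² + SX ∓ 1 ∈ ℤ[X]` in a number field is a UNIT of its ring of integers** (integral as a root of a monic integer
cubic; inverse `±(ε² − Tε + S)`, also integral). For a per-curve row this turns the unit bit of Chevalley's door into ONE field identity
(`T = Tr ε`, `S`, the norm sign), checked by `linear_combination` against `c_V(e₁) = 0`. [folklore] -/
theorem exists_isUnit_ringOfIntegers_of_cubicUnitEq {F : Type} [Field F] [NumberField F] (ε : F) (T S sgn : ℤ)
    (hsgn : sgn = 1 ∨ sgn = -1) (hid : ε ^ 3 - T * ε ^ 2 + S * ε - sgn = 0) :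
    ∃ η : 𝓞 F, IsUnit η ∧ (η : F) = ε := by
  have hint : IsIntegral ℤ ε := by
    refine ⟨X ^ 3 - C T * X ^ 2 + C S * X - C sgn, by monicity!, ?_⟩
    simp only [eval₂_add, eval₂_sub, eval₂_mul, eval₂_X_pow, eval₂_C, eval₂_X]
    simp only [algebraMap_int_eq, eq_intCast]
    linear_combination hid
  have hint' : IsIntegral ℤ ((sgn : F) * (ε ^ 2 - T * ε + S)) :=
    (isIntegral_algebraMap (x := sgn)).mul (((hint.pow 2).sub ((isIntegral_algebraMap (x := T)).mul hint)).add
      (isIntegral_algebraMap (x := S)))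
  have hsgn2 : (sgn : F) * sgn = 1 := by
    rcases hsgn with rfl | rfl <;> push_cast <;> norm_num
  refine ⟨⟨ε, hint⟩, ?_, rfl⟩
  rw [isUnit_iff_exists_inv]
  refine ⟨⟨(sgn : F) * (ε ^ 2 - T * ε + S), hint'⟩, Subtype.ext ?_⟩
  change ε * ((sgn : F) * (ε ^ 2 - T * ε + S)) = 1
  linear_combination (sgn : F) * hid + hsgn2

/-- **The unit bit, decidable end to end (generic cubic `2`-torsion field).**  `V/ℚ` globally minimal, good ordinary at `2`, `E_V(ℚ)[2] = 0`;
`F` cubic with a root `e₁` of `c_V`; `ε = P(e₁)/(2^k m)` with the cubic unit equation `ε³ − Tε² + Sε − sgn = 0` (`sgn = ±1`) and the `2`-adic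
sign certificate `(a, m', c)`. Then there is a unit `η` of `𝓞 F` with `η = ε` and `η ≠ α² − 2β²` for all `α, β ∈ F` — both displayed inputs
(`hεu`, `hnn`) of bsd-2adic's Chevalley door `classNumberPExp_one_eq_zero_of_nonNorm_unit_two` from finitely many integers.
[cite: Serre1973, Ch. III §1.2 Thm. 1] [cite: Lang1990, Ch. 13 §4, Lemma 4.1] -/
theorem exists_isUnit_forall_ne_sq_sub_two_mul_sq_of_certs (V : WeierstrassCurve ℚ) [V.IsElliptic] [V.IsGloballyMinimal]
    (hord : IsOrdinaryAt V 2) (ht : ∀ x : ℚ, ¬ HasRationalTwoTorsionX V x)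
    {F : Type} [Field F] [NumberField F] (hF : Module.finrank ℚ F = 3) {e₁ : F} (he₁ : aeval e₁ (twoDivisionUCubic V) = 0)
    (P : ℤ[X]) (k : ℕ) (m m' a c T S sgn : ℤ) (hsgn : sgn = 1 ∨ sgn = -1)
    (hid : (aeval e₁ (P.map (Int.castRingHom ℚ)) / (2 ^ k * (m : F))) ^ 3
        - T * (aeval e₁ (P.map (Int.castRingHom ℚ)) / (2 ^ k * (m : F))) ^ 2
        + S * (aeval e₁ (P.map (Int.castRingHom ℚ)) / (2 ^ k * (m : F))) - sgn = 0)
    (hc : c = 3 ∨ c = 5) (ha : Odd a)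
    (hroot : (2 : ℤ) ^ (k + 3) ∣
      a ^ 3 + (integralModelInt V).b₂ * a ^ 2 + 8 * (integralModelInt V).b₄ * a + 16 * (integralModelInt V).b₆)
    (hmm : ((m * m' : ℤ) : ZMod (2 ^ 3)) = 1)
    (hcert : ((P.eval a * m' : ℤ) : ZMod (2 ^ (k + 3))) = ((2 ^ k * c : ℤ) : ZMod (2 ^ (k + 3)))) :
    ∃ η : 𝓞 F, IsUnit η ∧ (η : F) = aeval e₁ (P.map (Int.castRingHom ℚ)) / (2 ^ k * (m : F)) ∧
      ∀ α β : F, (η : F) ≠ α ^ 2 - 2 * β ^ 2 := by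
  obtain ⟨η, hηu, hη⟩ := exists_isUnit_ringOfIntegers_of_cubicUnitEq _ T S sgn hsgn hid
  refine ⟨η, hηu, hη, ?_⟩
  rw [hη]
  exact forall_ne_sq_sub_two_mul_sq_of_signCert V hord ht hF he₁ P k m m' a c hc ha hroot hmm hcert

end UnitCert

end Summit.BirchSwinnertonDyer.BirchSwinnertonDyer.Theorems.AlignedTransportAtTwoCubicChevalleyUnitSign

end
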